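import Mathlib.Tactic.Ring
import Literature.Algebra.EuclideanDomain.MotzkinConstruction
import HarnessLib

/-!
# Superadditivity of the minimal Euclidean function (Lenstra; Conidis–Nielsen–Tombs 2019, Lemma 5)

Topic `Literature/Algebra/EuclideanDomain`, namespace `Literature.Algebra.EuclideanDomain`.  THEOREMS ONLY, all
proved, in the vocabulary of `MotzkinConstruction.lean` (`motzkinSet k = P₀^{(k)}`, `motzkinRank`, `motzkinNorm` =
Motzkin's fastest norm = the minimal Euclidean function `τ`).

## Source (read at the page)

C. J. Conidis, P. P. Nielsen, V. Tombs, *Transfinitely valued Euclidean domains have arbitrary indecomposable order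
type*, Comm. Algebra **47** (2019) 1105–1113 [ConidisNielsenTombs2019] (materialised `paper:arxiv-1703.02631`, §3,
p. 5), VERBATIM: «Since `log(xy) = log(x) + log(y)`, we have `τ_ℤ(xy) ≥ τ_ℤ(x) + τ_ℤ(y)`, for any `x, y ∈ ℤ∖{0}`.
Surprisingly, all minimal Euclidean norms satisfy a similar property.  After discovering this fact we subsequently
chanced upon Proposition 3.4 in Lenstra's lecture notes [Lenstra] (H. W. Lenstra, *Lectures on Euclidean rings*,
Bielefeld 1974), which established the result forty years earlier (by essentially the same proof, which we
therefore do not include).»  **Lemma 5.** «Let `R` be a Euclidean domain with minimal Euclidean norm `τ`.  If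
`x, y ∈ R∖{0}`, then `τ(xy) ≥ τ(x) ⊕ τ(y)`.»  (Remark 10: «Lenstra observed … that for all (then) known finitely
valued Euclidean domains … `τ(x) + τ(y) ≤ τ(xy) ≤ τ(x) + τ(y) + k`»; the upper bound fails in general.)

## What is formalised, and the proof

The tree's Motzkin construction is the finitely valued one (`motzkinSet : ℕ → Set R`), so we prove the `ℕ`-valued
case, where the natural sum `⊕` is `+`.
-- TODO(general form): ordinal-indexed Motzkin sets `S_α(R)` and `τ(xy) ≥ τ(x) ⊕ τ(y)` with the Hessenberg sum.
The heart is the set-theoretic statement **`P₀^{(i)} · P₀^{(j)} ⊆ P₀^{(i+j)}`** in an integral domain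
(`mul_mem_motzkinSet_add`), proved by induction on `i + j` (the source prints no proof; this is ours): for
`x ∈ P₀^{(i)} = (P₀^{(i−1)})′` pick Motzkin's witness `a₀` with `a₀ + xR ⊆ P₀^{(i−1)}`; then `a₀y` witnesses
`xy ∈ (P₀^{(i+j−1)})′`, because `a₀y + xyq = (a₀ + xq)·y ∈ P₀^{(i−1)} · P₀^{(j)} ⊆ P₀^{(i+j−1)}` by induction, and
`xy ∈ P₀^{(i+j−1)}` likewise.  Since `τ(b) ≥ k ↔ b ∈ P₀^{(k)}` for `b ≠ 0` (`mem_motzkinSet_motzkinNorm`,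
`motzkinRank_le_iff`), Lemma 5 follows (`motzkinNorm_add_le_motzkinNorm_mul`), with the power form
`n·τ(x) ≤ τ(xⁿ)`.  (For `ℤ`, where `τ = ⌊log₂|·|⌋` by `Int.motzkinNorm_eq_log`, this is the displayed inequality.)

## Mathlib / tree search

Tree: `MotzkinConstruction.lean` (`mem_motzkinDerived`, `motzkinSet_succ`, `mul_mem_motzkinSet`,
`ne_zero_of_mem_motzkinSet`, `motzkinRank_le_iff`, `motzkinRank_eq_zero_iff`, `mem_motzkinSet_motzkinNorm`,
`motzkinNorm_le_of_dvd` — monotonicity under divisibility, the case `τ(y) = 0` of the present result); nothing on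
products of two Motzkin sets (`rg "motzkinSet \(i \+ j\)|motzkinNorm_mul"` → none).  Mathlib has no minimal
Euclidean function.
-/

namespace Literature.Algebra.EuclideanDomain

universe u

variable {R : Type u} [CommRing R] [IsDomain R]

/-! ## §1 Products of Motzkin's sets -/

/-- **`P₀^{(i)} · P₀^{(j)} ⊆ P₀^{(i+j)}`** in an integral domain: if `x ∈ P₀^{(i)}` and `y ∈ P₀^{(j)}` then
`xy ∈ P₀^{(i+j)}` (induction on `i + j`; the witness for `xy` is `a₀·y`, `a₀` the witness for `x`).  This is the
set form of Lenstra's `τ(xy) ≥ τ(x) + τ(y)`. [cite: ConidisNielsenTombs2019, Lemma 5] -/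
theorem mul_mem_motzkinSet_add {i j : ℕ} {x y : R} (hx : x ∈ (motzkinSet i : Set R))
    (hy : y ∈ (motzkinSet j : Set R)) : x * y ∈ (motzkinSet (i + j) : Set R) := by
  suffices H : ∀ m : ℕ, ∀ i j : ℕ, i + j = m → ∀ x y : R,
      x ∈ (motzkinSet i : Set R) → y ∈ (motzkinSet j : Set R) → x * y ∈ (motzkinSet m : Set R) from
    H _ i j rfl x y hx hy
  intro m
  induction m with
  | zero =>
    intro i j hij x y hx hy
    rw [motzkinSet_zero, Set.mem_setOf_eq]
    exact mul_ne_zero (ne_zero_of_mem_motzkinSet hx) (ne_zero_of_mem_motzkinSet hy)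
  | succ m ih =>
    intro i j hij x y hx hy
    cases i with
    | zero =>
      -- `x ≠ 0` and `y ∈ P₀^{(m+1)}`: closure under non-zero multiples
      rw [Nat.zero_add] at hij
      subst hij
      rw [mul_comm]
      exact mul_mem_motzkinSet hy (ne_zero_of_mem_motzkinSet hx)
    | succ i =>
      rw [motzkinSet_succ, mem_motzkinDerived] at hx
      obtain ⟨hx', a₀, ha₀⟩ := hx
      have him : i + j = m := by omega
      rw [motzkinSet_succ, mem_motzkinDerived]
      refine ⟨ih i j him x y hx' hy, a₀ * y, fun q ↦ ?_⟩
      rw [show a₀ * y + x * y * q = (a₀ + x * q) * y by ring]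
      exact ih i j him _ y (ha₀ q) hy

/-- Iterating: `x ∈ P₀^{(i)}` implies `xⁿ ∈ P₀^{(n·i)}`. [cite: ConidisNielsenTombs2019, Lemma 5] -/
theorem pow_mem_motzkinSet_mul {i : ℕ} {x : R} (hx : x ∈ (motzkinSet i : Set R)) (n : ℕ) :
    x ^ n ∈ (motzkinSet (n * i) : Set R) := by
  induction n with
  | zero =>
    rw [Nat.zero_mul, pow_zero, motzkinSet_zero, Set.mem_setOf_eq]
    exact one_ne_zero
  | succ n ih =>
    rw [pow_succ, Nat.succ_mul]
    exact mul_mem_motzkinSet_add ih hx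

/-! ## §2 Lemma 5: `τ(xy) ≥ τ(x) + τ(y)` for the minimal Euclidean function -/

section Norm

variable (h : ∀ b : R, ∃ k : ℕ, b ∉ (motzkinSet k : Set R))

/-- Rank form: `rank x + rank y ≤ rank (xy) + 1` for `x, y ≠ 0` (`rank = τ + 1` off `0`).
[cite: ConidisNielsenTombs2019, Lemma 5] -/
theorem motzkinRank_add_le_motzkinRank_mul_add_one {x y : R} (hx : x ≠ 0) (hy : y ≠ 0) :
    motzkinRank h x + motzkinRank h y ≤ motzkinRank h (x * y) + 1 := by
  have hx1 : motzkinRank h x ≠ 0 := fun e ↦ hx ((motzkinRank_eq_zero_iff h).mp e)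
  have hy1 : motzkinRank h y ≠ 0 := fun e ↦ hy ((motzkinRank_eq_zero_iff h).mp e)
  -- `x ∈ P₀^{(rank x − 1)}`, `y ∈ P₀^{(rank y − 1)}`, hence `xy ∈ P₀^{(rank x + rank y − 2)}`
  have hxm : x ∈ (motzkinSet (motzkinRank h x - 1) : Set R) :=
    mem_motzkinSet_of_lt_motzkinRank h (by omega)
  have hym : y ∈ (motzkinSet (motzkinRank h y - 1) : Set R) :=
    mem_motzkinSet_of_lt_motzkinRank h (by omega)
  have hxy := mul_mem_motzkinSet_add hxm hym
  -- so `rank (xy) > rank x + rank y − 2`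
  by_contra hlt
  have hle : motzkinRank h (x * y) ≤ motzkinRank h x - 1 + (motzkinRank h y - 1) := by omega
  exact (motzkinRank_le_iff h).mp hle hxy

/-- **Lemma 5 (Lenstra's Proposition 3.4), finitely valued case.** «Let `R` be a Euclidean domain with minimal
Euclidean norm `τ`.  If `x, y ∈ R∖{0}`, then `τ(xy) ≥ τ(x) ⊕ τ(y)`» — here `τ = motzkinNorm` (Motzkin's fastest
norm, defined under the criterion `h`) and `⊕ = +`. [cite: ConidisNielsenTombs2019, Lemma 5] -/
theorem motzkinNorm_add_le_motzkinNorm_mul {x y : R} (hx : x ≠ 0) (hy : y ≠ 0) :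
    motzkinNorm h x + motzkinNorm h y ≤ motzkinNorm h (x * y) := by
  have := motzkinRank_add_le_motzkinRank_mul_add_one h hx hy
  have hx1 : motzkinRank h x ≠ 0 := fun e ↦ hx ((motzkinRank_eq_zero_iff h).mp e)
  have hy1 : motzkinRank h y ≠ 0 := fun e ↦ hy ((motzkinRank_eq_zero_iff h).mp e)
  unfold motzkinNorm
  omega

/-- The same via Motzkin's sets: `xy ∈ P₀^{(τ x + τ y)}` for `x, y ≠ 0`. [cite: ConidisNielsenTombs2019, Lemma 5] -/
theorem mul_mem_motzkinSet_motzkinNorm_add {x y : R} (hx : x ≠ 0) (hy : y ≠ 0) :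
    x * y ∈ (motzkinSet (motzkinNorm h x + motzkinNorm h y) : Set R) :=
  mul_mem_motzkinSet_add (mem_motzkinSet_motzkinNorm h hx).1 (mem_motzkinSet_motzkinNorm h hy).1

/-- Powers: `n · τ(x) ≤ τ(xⁿ)` for `x ≠ 0`. [cite: ConidisNielsenTombs2019, Lemma 5] -/
theorem mul_motzkinNorm_le_motzkinNorm_pow {x : R} (hx : x ≠ 0) (n : ℕ) :
    n * motzkinNorm h x ≤ motzkinNorm h (x ^ n) := by
  induction n with
  | zero => simp
  | succ n ih =>
    have hxn : x ^ n ≠ 0 := pow_ne_zero n hx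
    have := motzkinNorm_add_le_motzkinNorm_mul h hxn hx
    rw [← pow_succ] at this
    rw [Nat.succ_mul]
    omega

/-- In particular a non-unit `x ≠ 0` (`τ(x) ≥ 1`) has `τ(xⁿ) ≥ n`: the minimal Euclidean function is unbounded on
the powers of any non-zero non-unit. [cite: ConidisNielsenTombs2019, Lemma 5] -/
theorem le_motzkinNorm_pow_of_not_isUnit {x : R} (hx : x ≠ 0) (hu : ¬IsUnit x) (n : ℕ) :
    n ≤ motzkinNorm h (x ^ n) := by
  have h1 : 1 ≤ motzkinNorm h x := by
    -- `x ∈ P₀′` (a non-zero non-unit), so `rank x ≥ 2`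
    have hx1 : x ∈ (motzkinSet 1 : Set R) := by rw [motzkinSet_one]; exact ⟨hx, hu⟩
    have : ¬motzkinRank h x ≤ 1 := fun hle ↦ (motzkinRank_le_iff h).mp hle hx1
    unfold motzkinNorm
    omega
  have := mul_motzkinNorm_le_motzkinNorm_pow h hx n
  nlinarith

end Norm

/-! ## §3 The integers: `⌊log₂|xy|⌋ ≥ ⌊log₂|x|⌋ + ⌊log₂|y|⌋` -/

/-- The displayed example: «Since `log(xy) = log(x) + log(y)`, we have `τ_ℤ(xy) ≥ τ_ℤ(x) + τ_ℤ(y)`, for any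
`x, y ∈ ℤ∖{0}`» — with `τ_ℤ = ⌊log₂|·|⌋` (`Int.motzkinNorm_eq_log`). [cite: ConidisNielsenTombs2019, §3 (p. 5)] -/
theorem Int.log_natAbs_mul_ge {x y : ℤ} (hx : x ≠ 0) (hy : y ≠ 0) :
    Nat.log 2 x.natAbs + Nat.log 2 y.natAbs ≤ Nat.log 2 (x * y).natAbs := by
  have := motzkinNorm_add_le_motzkinNorm_mul Int.forall_exists_not_mem_motzkinSet hx hy
  rwa [Int.motzkinNorm_eq_log hx, Int.motzkinNorm_eq_log hy, Int.motzkinNorm_eq_log (mul_ne_zero hx hy)] at this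

end Literature.Algebra.EuclideanDomain
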